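import Summits.BirchSwinnertonDyer.Rank1Residual.P2.CongruentNumberEvenAokiMonskyForms
import HarnessLib

/-!
# Cell `bsd-monsky`: AOKI = MONSKY, THE ODD CLASSES — part 0, two identities for `Lᵀ = L + εεᵀ + D_ε`
# (pure `𝔽₂`-linear algebra; nothing arithmetic asserted)

HONEST FRAMING (cell `bsd-monsky`, run/shared/lean/pub/bsd-monsky/, README §1). This file asserts NO arithmetic
fact. For the ODD half (`n = p₁⋯p_k ≡ 3, 7 (mod 8)`) of «Aoki 1999 Thm 2.2 = Monsky's matrix count» (the even half
is the tree theorem `AokiMonsky.selmerDimFormula_two_mul_prod`), with `L = Aᵀ` Aoki's symbol matrix for odd `n`,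
`Lᵀ = L + εεᵀ + D_ε` (quadratic reciprocity), zero column sums of `L` and `Σ ε = 1` (`n ≡ 3 (mod 4)`):
* `dotProduct_vecMul_add_dotProduct_vecMul` — `w ⬝ (s ᵥ* L) + s ⬝ (w ᵥ* L) = (ε ⬝ w)(ε ⬝ s) + Σ_j ε_j w_j s_j`
  (`= wᵀ(L + Lᵀ)s`), the identity behind both inclusions of the odd kernel count;
* `sum_vecMul_apply_eq_zero` — the row sums of `L` vanish too.
The kernel count itself is `…OddAokiMonskyKernel.lean`. Companion note HOME/proof/PROOF-B-AOKI-MONSKY.md §5.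

References: [Aoki1999] Thm. 2.2 p. 81; [HeathBrown1994SelmerCongruentII] Appendix (Monsky), typescript p. 39 L10–L33;
[IrelandRosen1990] Ch. 5 §2.
-/

noncomputable section

open scoped Classical

open Matrix

set_option autoImplicit false

namespace Summit.BirchSwinnertonDyer.Rank1Residual.P2.AokiMonsky

section OddForms

variable {ι : Type*} [Fintype ι] [DecidableEq ι] (L : Matrix ι ι (ZMod 2)) (ε t : ι → ZMod 2)

/-- **`wᵀ(L + Lᵀ)s`**: `w ⬝ (s ᵥ* L) + s ⬝ (w ᵥ* L) = (ε ⬝ w)(ε ⬝ s) + Σ_j ε_j w_j s_j` from `Lᵀ = L + εεᵀ + D_ε`.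
[folklore] -/
theorem dotProduct_vecMul_add_dotProduct_vecMul
    (hLT : ∀ i j, L j i = L i j + ε i * ε j + if i = j then ε i else 0) (w s : ι → ZMod 2) :
    w ⬝ᵥ (s ᵥ* L) + s ⬝ᵥ (w ᵥ* L) = (∑ i, ε i * w i) * (∑ i, ε i * s i) + ∑ i, ε i * (w i * s i) := by
  have eq1 : w ⬝ᵥ (s ᵥ* L) = ∑ j, ∑ i, w j * (s i * L i j) := by
    simp only [dotProduct, Matrix.vecMul, Finset.mul_sum]
  have eq2 : s ⬝ᵥ (w ᵥ* L) = ∑ j, ∑ i, w j * (s i * L j i) := by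
    simp only [dotProduct, Matrix.vecMul, Finset.mul_sum]
    rw [Finset.sum_comm]
    exact Finset.sum_congr rfl fun j _ => Finset.sum_congr rfl fun i _ => by ring
  have key1 : ∀ a b c e : ZMod 2, a * (b * c) + a * (b * c) = e * a * (e * b) + e * (a * b) := by decide
  have key2 : ∀ a b c e f : ZMod 2, a * (b * c) + a * (b * (c + e * f + 0)) = f * a * (e * b) + 0 := by
    decide
  have hpt : ∀ i j, w j * (s i * L i j) + w j * (s i * L j i) =
      ε j * w j * (ε i * s i) + (if i = j then ε i * (w i * s i) else 0) := by
    intro i j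
    by_cases h : i = j
    · subst h
      rw [if_pos rfl]
      exact key1 _ _ _ _
    · rw [hLT i j, if_neg h, if_neg h]
      exact key2 _ _ _ _ _
  rw [eq1, eq2, ← Finset.sum_add_distrib]
  have hin : ∀ j, (∑ i, w j * (s i * L i j)) + ∑ i, w j * (s i * L j i) =
      ε j * w j * (∑ i, ε i * s i) + ε j * (w j * s j) := by
    intro j
    rw [← Finset.sum_add_distrib, Finset.sum_congr rfl fun i _ => hpt i j, Finset.sum_add_distrib,
      ← Finset.mul_sum, Finset.sum_ite_eq', if_pos (Finset.mem_univ j)]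
  rw [Finset.sum_congr rfl fun j _ => hin j, Finset.sum_add_distrib, ← Finset.sum_mul]

/-- Row sums of `L` vanish too: `Σ_j (s ᵥ* L)_j = 0` (zero column sums of `L`, `Lᵀ = L + εεᵀ + D_ε`, `Σ ε = 1`).
[folklore] -/
theorem sum_vecMul_apply_eq_zero
    (hLT : ∀ i j, L j i = L i j + ε i * ε j + if i = j then ε i else 0)
    (hcol : ∀ i, ∑ j, L j i = 0) (hodd : ∑ j, ε j = 1) (s : ι → ZMod 2) : ∑ j, (s ᵥ* L) j = 0 := by
  classical
  have hrow : ∀ i, ∑ j, L i j = 0 := by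
    intro i
    have h : ∑ j, L i j = ∑ j, (L j i + ε i * ε j + if i = j then ε i else 0) :=
      Finset.sum_congr rfl fun j _ => by
        rw [hLT i j]
        have : ∀ a b c : ZMod 2, a = a + b + c + b + c := by decide
        exact this _ _ _
    rw [h, Finset.sum_add_distrib, Finset.sum_add_distrib, hcol i, ← Finset.mul_sum, hodd,
      Finset.sum_ite_eq, if_pos (Finset.mem_univ i)]
    have : ∀ e : ZMod 2, 0 + e * 1 + e = 0 := by decide
    exact this _
  simp only [Matrix.vecMul, dotProduct]
  rw [Finset.sum_comm]
  exact Finset.sum_eq_zero fun i _ => by rw [← Finset.mul_sum, hrow i, mul_zero]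

end OddForms

end Summit.BirchSwinnertonDyer.Rank1Residual.P2.AokiMonsky

end
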